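import Mathlib
import Summits.Ventures.PercRepro2.Defs
import Summits.Ventures.PercRepro2.Independence
import Summits.Ventures.PercRepro2.Harris
import Summits.Ventures.PercRepro2.Graph
import Summits.Ventures.PercRepro2.Exploration
import Summits.Ventures.PercRepro2.Events
import Summits.Ventures.PercRepro2.FourFunctions
import Summits.Ventures.PercRepro2.Induced
import Summits.Ventures.PercRepro2.Frontier
import Summits.Ventures.PercRepro2.ObsIndependence
import Summits.Ventures.PercRepro2.BHK
import Summits.Ventures.PercRepro2.BHKEvents
import Summits.Ventures.PercRepro2.MultiSource
import Summits.Ventures.PercRepro2.OrderPreservation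
import Summits.Ventures.PercRepro2.SeedSet
import Summits.Ventures.PercRepro2.MultiSourceFun
import Summits.Ventures.PercRepro2.CrossRootT
import Summits.Ventures.PercRepro2.VdBKahn
import Summits.Ventures.PercRepro2.HullDefs
import Summits.Ventures.PercRepro2.CCTRootEdge
import Summits.Ventures.PercRepro2.CCTAvoidedEdge
import Summits.Ventures.PercRepro2.R1Rung
import Summits.Ventures.PercRepro2.CC2Rung
import Summits.Ventures.PercRepro2.PASubDefs
import Summits.Ventures.PercRepro2.PASub
import Summits.Ventures.PercRepro2.HalfN
import Summits.Ventures.PercRepro2.PAK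
import Summits.Ventures.PercRepro2.CCTLin
import Summits.Ventures.PercRepro2.BasePrime
import Summits.Ventures.PercRepro2.BasePendant
import Summits.Ventures.PercRepro2.L1KPendant
import Summits.Ventures.PercRepro2.L1KAvoidedEdge

/-!
# (L1-K) from two shifts of the same sign; (L1-K) at every edge incident to the ROOT (blind cell
PercRepro2, typer-1; row 2′CCT-LIN — the root-edge case, the companion of `L1KAvoidedEdge`
(T-edges), `L1KPendant` (unmarked pendant edges) and `CCTRootEdge.ccT_root_edge` ((CC-T) at root
edges, mine-c §9.10 (i)))

The algebra of `L1KAvoidedEdge` isolated: with the partition sums as the `e`-open masses and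
(PA-K) `F₁ᵃ F₁ᵇ ≤ Σx₁y₁λ₁ · P₁`, the exact identity
`P₁ · L = P₀² (P₁ Σx₁y₁λ₁ − F₁ᵃ F₁ᵇ) + (P₀ F₁ᵃ − P₁ F₀ᵃ)(P₀ F₁ᵇ − P₁ F₀ᵇ)`
(`L1KAvoidedEdge.L1K_expr_identity`) gives (L1-K) whenever the two shifts have the same sign:

* **`L1K_of_shift_product`**: `0 ≤ (F₁ᵃ P₀ − F₀ᵃ P₁)(F₁ᵇ P₀ − F₀ᵇ P₁) → L1K` (any edge);
* **`L1K_root_edge`**: (L1-K) at every edge `e = {s, w}` — both shifts are `≥ 0` there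
  (`CCT.shift_root_edge`, mine-c §9.10 (i)).

Status of row 2′CCT-LIN, (L1-K): a theorem at root edges, at T-edges and at unmarked pendant
edges; open exactly at the free edges where the two shifts have opposite signs.
-/

namespace Summit.Ventures.PercRepro2

namespace L1KRootEdge

open PASub HalfN TwoSetRung CCTLin

open scoped Classical

variable {V : Type*} {E : Type*} [Fintype E] [DecidableEq E] [Fintype V] [DecidableEq V]
  {R : Type*} [Field R] [LinearOrder R] [IsStrictOrderedRing R]

variable (p : E → R) (ends : E → Sym2 V) (e : E) (s : V) (T : Finset V)

/-- **(L1-K) from two shifts of the same sign** (any edge): if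
`0 ≤ (F₁ᵃ P₀ − F₀ᵃ P₁)(F₁ᵇ P₀ − F₀ᵇ P₁)` then `L1K p ends e s T a b`. -/
theorem L1K_of_shift_product (hp : IsProbVec p) (a b : V)
    (hprod : 0 ≤ (prob (Function.update p e 1) (avoidAll ends s T ∩ connAll ends s {a}) *
        prob (Function.update p e 0) (avoidAll ends s T) -
      prob (Function.update p e 0) (avoidAll ends s T ∩ connAll ends s {a}) *
        prob (Function.update p e 1) (avoidAll ends s T)) *
      (prob (Function.update p e 1) (avoidAll ends s T ∩ connAll ends s {b}) *
        prob (Function.update p e 0) (avoidAll ends s T) -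
      prob (Function.update p e 0) (avoidAll ends s T ∩ connAll ends s {b}) *
        prob (Function.update p e 1) (avoidAll ends s T))) :
    L1K p ends e s T a b := by
  unfold L1K
  have hp₁ : IsProbVec (Function.update p e 1) := hp.update e zero_le_one le_rfl
  have hk := PAK.paK p ends e s T hp a b
  rw [L1KPendant.sum_x_lambda_eq p ends e s T a, L1KPendant.sum_x_lambda_eq p ends e s T b,
    L1KPendant.sum_lambda_eq p ends e s T] at hk ⊢
  have hSxy : 0 ≤ ∑ W : Set V, if s ∉ W then
      prob p (XdelP ends e s W a) * prob p (XdelP ends e s W b) * prob p (KEvent ends e T W)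
      else 0 :=
    Finset.sum_nonneg fun W _ => by
      split_ifs <;> first
        | exact mul_nonneg (mul_nonneg (prob_nonneg hp _) (prob_nonneg hp _)) (prob_nonneg hp _)
        | exact le_rfl
  unfold massP massF at hk ⊢
  set P₀ := prob (Function.update p e 0) (avoidAll ends s T) with hP₀def
  set P₁ := prob (Function.update p e 1) (avoidAll ends s T) with hP₁def
  set F₀a := prob (Function.update p e 0) (avoidAll ends s T ∩ connAll ends s {a}) with hF₀a
  set F₀b := prob (Function.update p e 0) (avoidAll ends s T ∩ connAll ends s {b}) with hF₀b
  set F₁a := prob (Function.update p e 1) (avoidAll ends s T ∩ connAll ends s {a}) with hF₁a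
  set F₁b := prob (Function.update p e 1) (avoidAll ends s T ∩ connAll ends s {b}) with hF₁b
  set Sxy := ∑ W : Set V, if s ∉ W then
      prob p (XdelP ends e s W a) * prob p (XdelP ends e s W b) * prob p (KEvent ends e T W)
      else 0 with hSxydef
  rcases (prob_nonneg hp₁ (avoidAll ends s T)).lt_or_eq with hpos | hzero
  · have h1 : 0 ≤ P₀ ^ 2 * (P₁ * Sxy - F₁a * F₁b) :=
      mul_nonneg (sq_nonneg _) (by linarith [hk])
    have h2 : 0 ≤ (P₀ * F₁a - P₁ * F₀a) * (P₀ * F₁b - P₁ * F₀b) := by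
      have : (P₀ * F₁a - P₁ * F₀a) * (P₀ * F₁b - P₁ * F₀b) =
          (F₁a * P₀ - F₀a * P₁) * (F₁b * P₀ - F₀b * P₁) := by ring
      rw [this]
      exact hprod
    have hmul : 0 ≤ P₁ * (P₀ ^ 2 * Sxy - P₀ * (F₀a * F₁b + F₀b * F₁a) + F₀a * F₀b * P₁) := by
      rw [L1KAvoidedEdge.L1K_expr_identity]
      exact add_nonneg h1 h2
    exact nonneg_of_mul_nonneg_right hmul hpos
  · have hF₁a0 : F₁a = 0 :=
      le_antisymm (hzero ▸ prob_mono hp₁ Set.inter_subset_left) (prob_nonneg hp₁ _)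
    have hF₁b0 : F₁b = 0 :=
      le_antisymm (hzero ▸ prob_mono hp₁ Set.inter_subset_left) (prob_nonneg hp₁ _)
    have hSxy0 : Sxy = 0 := by
      refine le_antisymm ?_ hSxy
      have hle : Sxy ≤ ∑ W : Set V, if s ∉ W then prob p (KEvent ends e T W) else 0 := by
        refine Finset.sum_le_sum fun W _ => ?_
        split_ifs
        · exact le_rfl
        · have hx := prob_le_one hp (XdelP ends e s W a)
          have hy := prob_le_one hp (XdelP ends e s W b)
          have hy0 := prob_nonneg hp (XdelP ends e s W b)
          have hl0 := prob_nonneg hp (KEvent ends e T W)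
          calc prob p (XdelP ends e s W a) * prob p (XdelP ends e s W b) * prob p (KEvent ends e T W)
              ≤ 1 * 1 * prob p (KEvent ends e T W) :=
                mul_le_mul_of_nonneg_right (mul_le_mul hx hy hy0 zero_le_one) hl0
            _ = prob p (KEvent ends e T W) := by ring
      rw [L1KPendant.sum_lambda_eq p ends e s T] at hle
      unfold massP at hle
      linarith [hle, hzero]
    have hP₁0 : P₁ = 0 := by rw [hP₁def]; exact hzero.symm
    rw [hF₁a0, hF₁b0, hSxy0, hP₁0]
    simp

/-- **(L1-K) at every edge incident to the root** (`e = {s, w}`): both shifts are `≥ 0`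
(`CCT.shift_root_edge`), so `L1K_of_shift_product` applies. -/
theorem L1K_root_edge (hp : IsProbVec p) {w : V} (hends : ends e = s(s, w)) (a b : V) :
    L1K p ends e s T a b := by
  refine L1K_of_shift_product p ends e s T hp a b ?_
  have hA := CCT.shift_root_edge p ends hp hends T (𝓤 := {S : Set V | ↑({a} : Finset V) ⊆ S})
    (fun _ _ hST h => h.trans hST)
  have hB := CCT.shift_root_edge p ends hp hends T (𝓤 := {S : Set V | ↑({b} : Finset V) ⊆ S})
    (fun _ _ hST h => h.trans hST)
  rw [← CCT.connAll_eq_clusterInEvent] at hA hB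
  exact mul_nonneg (by linarith) (by linarith)

end L1KRootEdge

end Summit.Ventures.PercRepro2
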